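import Summits.ABC.IUTFork.Cor312QFrobNotNecessary
import Summits.ABC.IUTFork.Cor312LogKummerRoute2
import Summits.ABC.IUTFork.Cor312LogKummerRouteGlobal
import HarnessLib

/-!
# [IUTchIII] Cor. 3.12 — the log-Kummer route's hierarchy of inputs is STRICT (two kernel witnesses)

Proof-only-plus-witness file (D-0012) of the abc-iut cell (wave-5 prover seat abc-iut-w5-d087; ADJUDICATION support
for HUMAN RULING D-0067, `HOME/plan/ADJUDICATION-SPEC.md` §2 (G1′) «quantifier level», §4 (ii) «STRONGER-THAN-PRINT»);
TAKES NO SIDE; fact-free. Companion of `Cor312QFrobNotNecessary` (the witness `QFrobWitness.qfFull` / `qfSetting`).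

THE HIERARCHY (all landed, all over abc-iut-c312-7's verbatim `Cor312.Setting`, kurims `paper:url-4b091feeb646`
p. 173 l. 41 – p. 174 l. 19). Team B's log-Kummer route (abc-iut-c312-11 `Cor312LogKummerRoute`, `…Route2`) and its
global companion (abc-iut-w4-d022 `Cor312LogKummerRouteGlobal`) prove, under `BridgeHyps ∧ ThetaRegionsAdm` (+ (ii) (a)
`KummerA` for the holomorphic forms),
  `QFrobComparison ⟹ FrobVolumeTransport ⟹ VolumeTransport` (per packet: `∀ (j, v_ℚ) ∃ m`, the `q`-pilot volume is at
  most the volume of ONE Kummer image of the Θ-pilot object)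
  `⟹ GLOBAL volume transport` (`globalVolumeTransport_of_pointwise`: ONE inequality `−|log(q)| ≤` procession-normalised
  `∑ᶠ_{v_ℚ}` volume of a chosen family of single Kummer images — print's quantifier level, Step (xi-g) p. 184 l. 30–34)
  `⟹ Statement` (`statement_of_globalVolumeTransport`: `−|log(q)| ≤ −|log(Θ)|`, the volume of the HULL of the
  (Ind1), (Ind2), (Ind3)-orbit union).
w4-d022: "the converse is not claimed (sums do not control terms)". THIS FILE proves BOTH converses FAIL, each in an
instantiation where the typed Theorem 3.11 (i) ∧ (ii) ∧ (iii), every bridge hypothesis, `|log(q)| > 0`, admissibility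
of the Kummer images and (ii) (a) ALL HOLD:

* §1 `qf_globalVolumeTransport` — in `qfSetting` (Θ-image `{0}`/`q`-image everything at label `2`, swapped at label
  `1`; two-valued volume `−3`/`−1`) the GLOBAL transport HOLDS at the constant choice `m ≡ 0` (`−2 ≤ −2`) while the
  per-packet `VolumeTransport` FAILS (`QFrobWitness.qf_not_volumeTransport`): **per packet ⊋ global**
  (`global_not_imp_pointwise`).
* §2 `qgSetting` — same situation and column, hull frame `{everything}` (c312-6's `Cor312Vol.Checks.fullFrame`), EVERY Kummer image of
  the Θ-pilot object `{0}` (volume `−3`), `q`-pilot image everything (volume `−1`): the hull of the orbit union is the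
  whole packet, so `−|log(Θ)| = −|log(q)| = −1` and the typed **Corollary 3.12 HOLDS** (`qg_statement`), while for EVERY
  choice of positions the global single-image volume is `−3 < −1`: **the GLOBAL transport FAILS** (`qg_not_global`),
  hence so do `VolumeTransport`/`FrobVolumeTransport`/`QFrobComparison`: **global ⊋ Statement**
  (`statement_not_imp_global`). The hull of the orbit union can out-measure every single Kummer image — the print's
  `ℝ_{≤−|log(Θ)|}` ((xi-d) p. 183) is defined by the HULL volume, not by an image volume.
* §3 the layer-2 inputs of `…Route2` BY NAME at `qfSetting` (`qf_not_qFrobComparison`, `qf_not_qFrobEqualityAt`,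
  `qf_not_frobVolumeTransport'`) and the packaged certificate `qFrobComparison_not_necessary`.

READING FOR THE BLOCK (neutral, interface level): every input of the B-route — per packet OR global — is SUFFICIENT and
NOT NECESSARY for the typed Corollary granting the typed Thm. 3.11; with Team A's `GapWitness` (premises ⇏ Statement,
hence ⇏ any B-input) each is independent of the premises. A GAP row naming a B-input therefore carries the (G1′) flag
with these certificates; nothing here concerns the assembled real setting or whether Thm. 3.11 licenses Step (xi).
[claim: Mochizuki2012, status: disputed] for the quoted definitions; the theorems are [folklore] arithmetic.
-/

noncomputable section

namespace Summit.ABC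

namespace IUTFork

namespace Cor312Vol

namespace QFrobWitness

open Thm311 Cor312 Cor312.Checks Literature.IUT.LogThetaLattice LocalGlobal GapWitness

/-! ## 1. Per packet ⊋ global: the global transport HOLDS in `qfSetting` -/

/-- The single Kummer image volumes of `qfSetting` at the labels of `𝔽_l^⋇`: `−3` at label `2`, `−1` elsewhere
(independent of `m`). [folklore] -/
theorem qf_logvol_thetaRegion (m : ℤ) (i : Fin toyIndex.lstar) (vQ : toyIndex.VQ) :
    (qfSituation.D qfSetting.n).logvol (Setting.labelSucc i) vQ (qfSetting.thetaRegion m (Setting.labelSucc i) vQ) =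
      if (Setting.labelSucc i : toyIndex.Label) = 2 then (-3 : ℝ) else -1 := by
  show lgVol _ vQ (qfSetting.thetaRegion m (Setting.labelSucc i) vQ) = _
  rw [qf_thetaRegion]
  split_ifs
  · exact lgVol_of_subset Set.Subset.rfl
  · exact lgVol_univ _ vQ

/-- **The GLOBAL volume transport HOLDS in `qfSetting`** at the constant choice `m ≡ 0`: the procession-normalised
total of the single-image volumes is `((−1) + (−3))/2 = −2 = −|log(q)|` (finite supports: one place). [folklore] -/
theorem qf_globalVolumeTransport :
    qfSetting.negLogQ ≤ processionNormalized fun i : Fin toyIndex.lstar => ∑ᶠ vQ : toyIndex.VQ,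
      (qfSituation.D qfSetting.n).logvol (Setting.labelSucc i) vQ
        (qfSetting.thetaRegion ((fun _ _ => (0 : ℤ)) i vQ) (Setting.labelSucc i) vQ) := by
  rw [qf_negLogQ]
  simp only [qf_logvol_thetaRegion, finsum_unique]
  unfold processionNormalized
  rw [sum_fin_lstar, if_neg labelSucc_iOne_ne_two, if_pos labelSucc_iTwo]
  norm_num

/-- … so the GLOBAL route yields the (true) Statement of `qfSetting` — while the per-packet input fails there
(`qf_not_volumeTransport`). [folklore] -/
theorem qf_statement_via_global : Summit.ABC.IUTFork.Cor312.Setting.Statement qfSetting :=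
  statement_of_globalVolumeTransport qfSetting_bridgeHyps qf_thetaRegionsAdm (fun _ _ => 0)
    (fun _ => Set.toFinite _) qf_globalVolumeTransport

/-- **PER PACKET ⊋ GLOBAL.** An instantiation with typed Thm. 3.11, all bridge hypotheses, `|log(q)| > 0`,
admissible Kummer images, in which the GLOBAL volume transport holds (for a finitely supported choice of
positions) and the per-packet `VolumeTransport` fails. [folklore] -/
theorem global_not_imp_pointwise :
    ∃ (T : ThetaIndex) (F : FullSituation T) (P : Setting F.toLatticeSituation.toSituation)
      (m : Fin T.lstar → T.VQ → ℤ),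
      Summit.ABC.IUTFork.Thm311.FullSituation.Statement F ∧ Summit.ABC.IUTFork.Cor312Vol.BridgeHyps P ∧
        Summit.ABC.IUTFork.Cor312.Setting.AbsLogQPos P ∧ Summit.ABC.IUTFork.Cor312Vol.ThetaRegionsAdm P ∧
        (∀ i : Fin T.lstar, (Function.support fun vQ : T.VQ =>
          (F.D P.n).logvol (Setting.labelSucc i) vQ (P.thetaRegion (m i vQ) (Setting.labelSucc i) vQ)).Finite) ∧
        P.negLogQ ≤ (processionNormalized fun i : Fin T.lstar => ∑ᶠ vQ : T.VQ,
          (F.D P.n).logvol (Setting.labelSucc i) vQ (P.thetaRegion (m i vQ) (Setting.labelSucc i) vQ)) ∧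
        ¬ Summit.ABC.IUTFork.Cor312Vol.VolumeTransport P :=
  ⟨toyIndex, qfFull, qfSetting, fun _ _ => 0, qfFull_statement, qfSetting_bridgeHyps, qf_absLogQPos,
    qf_thetaRegionsAdm, fun _ => Set.toFinite _, qf_globalVolumeTransport, qf_not_volumeTransport⟩

/-! ## 2. Global ⊋ Statement: the hull out-measures every single Kummer image (`qgSetting`) -/

/-- The SECOND WITNESS SETTING over the same situation `qfSituation` (so the same typed Thm. 3.11 holds): hull
frame `{everything}` (c312-6's `fullFrame`: the only hull-set is the whole packet); EVERY Kummer image of the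
Θ-pilot object is `{0}` (volume `−3`); the `q`-pilot image is the whole packet (volume `−1`). [folklore] -/
def qgSetting : Setting qfSituation where
  n := 0
  HT := ℤ × ℤ
  LogLink := fun _ _ => Unit
  IsFull := fun _ => True
  lattice :=
    { theater := fun n m => (n, m)
      distinct := fun p q h => by simpa using h
      logLink := fun _ _ => ()
      logLink_full := fun _ _ => trivial }
  Frd := Unit
  IsoF := fun _ _ => Unit
  Ob := fun _ => Unit
  realify := id
  Strip := Unit
  IsoS := fun _ _ => Unit
  M := fun _ _ => Unit
  sig := toySig
  split := { Msplit := fun _ _ => ⊤, exists_gen := fun _ _ => ⟨⟨(), trivial⟩, top_unit_isGenerator _⟩ }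
  ObΔ := Unit
  N := fun _ _ => Unit
  qData := { q := fun _ _ => (), q_gen := fun _ _ => unit_isGenerator _, objOf := fun _ => () }
  frame := fun _ _ => Cor312Vol.Checks.fullFrame _
  hul_adm := fun _ _ _ _ => trivial
  thetaRegionOf := fun _ _ _ _ => {0}
  qRegionOf := fun _ _ _ => Set.univ
  qRegion_mem := fun _ _ => rfl
  qSupport_finite := fun _ => Set.toFinite _

/-- Every Kummer image of the Θ-pilot object is `{0}`. [folklore] -/
theorem qg_thetaRegion (m : ℤ) (j : toyIndex.Label) (vQ : toyIndex.VQ) : qgSetting.thetaRegion m j vQ = {0} := rfl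

/-- The (Ind3)-enlarged region is `{0}`. [folklore] -/
theorem qg_thetaRegion3 (j : toyIndex.Label) (vQ : toyIndex.VQ) : qgSetting.thetaRegion3 j vQ = {0} := by
  unfold Setting.thetaRegion3 Setting.thetaRegion
  exact Set.iUnion_const _

/-- The packet hull is the whole packet (the only hull-set). [folklore] -/
theorem qg_thetaHull (j : toyIndex.Label) (vQ : toyIndex.VQ) : qgSetting.thetaHull j vQ = Set.univ :=
  Cor312Vol.Checks.fullFrame_hull _ _

/-- Every union admits its hull. [folklore] -/
theorem qg_hullDefined (j : toyIndex.Label) (vQ : toyIndex.VQ) : qgSetting.HullDefined j vQ := ⟨trivial, trivial⟩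

/-- The local Θ-volume is `−1` everywhere (the hull is everything). [folklore] -/
theorem qg_thetaLocal (j : toyIndex.Label) (vQ : toyIndex.VQ) :
    qgSetting.thetaLocal j vQ = ((-1 : ℝ) : WithTop ℝ) := by
  unfold Setting.thetaLocal
  rw [if_pos (qg_hullDefined j vQ), qg_thetaHull]
  show ((lgVol j vQ Set.univ : ℝ) : WithTop ℝ) = _
  rw [lgVol_univ]

/-- The local `q`-volume is `−1` everywhere. [folklore] -/
theorem qg_qLocal (j : toyIndex.Label) (vQ : toyIndex.VQ) : qgSetting.qLocal j vQ = -1 := lgVol_univ j vQ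

/-- Every single Kummer image has volume `−3`. [folklore] -/
theorem qg_logvol_thetaRegion (m : ℤ) (j : toyIndex.Label) (vQ : toyIndex.VQ) :
    (qfSituation.D qgSetting.n).logvol j vQ (qgSetting.thetaRegion m j vQ) = -3 :=
  lgVol_of_subset Set.Subset.rfl

/-- `qgSetting` is `ThetaFinite`. [folklore] -/
theorem qg_thetaFinite : qgSetting.ThetaFinite :=
  ⟨fun i vQ => by rw [qg_thetaLocal]; exact WithTop.coe_ne_top, fun _ => Set.toFinite _⟩

/-- `−|log(Θ)| = −1`. [folklore] -/
theorem qg_negLogTheta : qgSetting.negLogTheta = ((-1 : ℝ) : WithTop ℝ) := by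
  rw [qgSetting.negLogTheta_eq_of_thetaFinite qg_thetaFinite]
  congr 1
  simp only [qg_thetaLocal, WithTop.untopD_coe, finsum_unique]
  exact processionNormalized_const (by decide) (-1)

/-- `−|log(q)| = −1`. [folklore] -/
theorem qg_negLogQ : qgSetting.negLogQ = -1 := by
  unfold Setting.negLogQ
  simp only [qg_qLocal, finsum_unique]
  exact processionNormalized_const (by decide) (-1)

/-- **The typed Corollary 3.12 HOLDS in `qgSetting`** (`−1 ≤ −1`). [folklore] -/
theorem qg_statement : Summit.ABC.IUTFork.Cor312.Setting.Statement qgSetting :=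
  (qgSetting.statement_iff_real qg_negLogTheta).mpr (by rw [qg_negLogQ])

/-- "`|log(q)| > 0`" in `qgSetting`. [folklore] -/
theorem qg_absLogQPos : Summit.ABC.IUTFork.Cor312.Setting.AbsLogQPos qgSetting := by
  show qgSetting.negLogQ < 0
  rw [qg_negLogQ]; norm_num

/-- All bridge hypotheses hold in `qgSetting`. [folklore] -/
theorem qgSetting_bridgeHyps : Summit.ABC.IUTFork.Cor312Vol.BridgeHyps qgSetting where
  mono := fun _ _ _ _ _ _ hAB => lgVol_mono hAB
  image_adm := fun _ _ _ _ => trivial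
  image_fin := fun _ => Set.toFinite _
  hul_nonempty := fun _ _ H hH => by
    rw [Set.mem_singleton_iff.mp hH]
    exact Set.univ_nonempty
  theta_nonempty := fun _ vQ => by rw [qg_thetaRegion3]; exact Set.singleton_nonempty 0
  finite := qg_thetaFinite

/-- The Kummer images are admissible in `qgSetting`. [folklore] -/
theorem qg_thetaRegionsAdm : Summit.ABC.IUTFork.Cor312Vol.ThetaRegionsAdm qgSetting := fun _ _ _ => trivial

/-- (ii) (a) for the column carrying `qgSetting`. [folklore] -/
theorem qg_kummerA : (qfFull.col qgSetting.n).KummerA (qfFull.D qgSetting.n) := qfColumn_kummerA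

/-- **The GLOBAL volume transport FAILS in `qgSetting` for EVERY choice of positions**: the procession-normalised
total of the single-image volumes is `−3 < −1 = −|log(q)|`. [folklore] -/
theorem qg_not_global (m : Fin toyIndex.lstar → toyIndex.VQ → ℤ) :
    ¬ qgSetting.negLogQ ≤ processionNormalized fun i : Fin toyIndex.lstar => ∑ᶠ vQ : toyIndex.VQ,
        (qfSituation.D qgSetting.n).logvol (Setting.labelSucc i) vQ
          (qgSetting.thetaRegion (m i vQ) (Setting.labelSucc i) vQ) := by
  rw [qg_negLogQ]
  simp only [qg_logvol_thetaRegion, finsum_unique]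
  rw [processionNormalized_const (by decide) (-3)]
  norm_num

/-- … hence the per-packet input fails there too (by name). [folklore] -/
theorem qg_not_volumeTransport : ¬ Summit.ABC.IUTFork.Cor312Vol.VolumeTransport qgSetting := by
  intro h
  obtain ⟨m, hm⟩ := h iTwo ()
  rw [qg_qLocal, qg_logvol_thetaRegion] at hm
  norm_num at hm

/-- … and the residual B-input of layer 2 (by name; the column is Kummer-exact). [folklore] -/
theorem qg_not_qFrobComparison :
    ¬ Summit.ABC.IUTFork.Cor312Vol.QFrobComparison (S' := qfFull.toLatticeSituation) qgSetting := by
  intro h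
  obtain ⟨m, hm⟩ := h iTwo ()
  have h1 : (qfFull.col qgSetting.n).frobLogvol m (Setting.labelSucc iTwo) ()
      (qgSetting.qRegion (Setting.labelSucc iTwo) ()) = -1 := lgVol_univ _ ()
  have h3 : (qfFull.col qgSetting.n).frobLogvol m (Setting.labelSucc iTwo) ()
      (qgSetting.thetaRegion m (Setting.labelSucc iTwo) ()) = -3 := lgVol_of_subset Set.Subset.rfl
  erw [h1, h3] at hm
  norm_num at hm

/-- **GLOBAL ⊋ STATEMENT.** An instantiation with typed Thm. 3.11 (i) ∧ (ii) ∧ (iii), all bridge hypotheses,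
`|log(q)| > 0`, admissible Kummer images and (ii) (a), in which the typed Corollary 3.12 HOLDS while the GLOBAL
volume transport FAILS for every choice of positions (and so do `VolumeTransport` and `QFrobComparison`): the hull
of the orbit union out-measures every single Kummer image. [folklore] -/
theorem statement_not_imp_global :
    ∃ (T : ThetaIndex) (F : FullSituation T) (P : Setting F.toLatticeSituation.toSituation),
      Summit.ABC.IUTFork.Thm311.FullSituation.Statement F ∧ Summit.ABC.IUTFork.Cor312Vol.BridgeHyps P ∧
        Summit.ABC.IUTFork.Cor312.Setting.AbsLogQPos P ∧ Summit.ABC.IUTFork.Cor312Vol.ThetaRegionsAdm P ∧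
        (F.col P.n).KummerA (F.D P.n) ∧ Summit.ABC.IUTFork.Cor312.Setting.Statement P ∧
        (∀ m : Fin T.lstar → T.VQ → ℤ,
          ¬ P.negLogQ ≤ processionNormalized fun i : Fin T.lstar => ∑ᶠ vQ : T.VQ,
            (F.D P.n).logvol (Setting.labelSucc i) vQ (P.thetaRegion (m i vQ) (Setting.labelSucc i) vQ)) ∧
        ¬ Summit.ABC.IUTFork.Cor312Vol.VolumeTransport P ∧
        ¬ Summit.ABC.IUTFork.Cor312Vol.QFrobComparison (S' := F.toLatticeSituation) P :=
  ⟨toyIndex, qfFull, qgSetting, qfFull_statement, qgSetting_bridgeHyps, qg_absLogQPos, qg_thetaRegionsAdm,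
    qg_kummerA, qg_statement, qg_not_global, qg_not_volumeTransport, qg_not_qFrobComparison⟩

/-! ## 3. The layer-2 inputs BY NAME at `qfSetting`, and the packaged certificate -/

/-- **`QFrobComparison` — the residual B-input — FAILS in `qfSetting`** (by name; `−1 ≤ −3` at label `2`).
[folklore] -/
theorem qf_not_qFrobComparison :
    ¬ Summit.ABC.IUTFork.Cor312Vol.QFrobComparison (S' := qfFull.toLatticeSituation) qfSetting :=
  qf_not_frobComparison

/-- **`QFrobEqualityAt m` FAILS in `qfSetting` for every `m`** (by name; `−1 = −3` at label `2`). [folklore] -/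
theorem qf_not_qFrobEqualityAt (m : ℤ) :
    ¬ Summit.ABC.IUTFork.Cor312Vol.QFrobEqualityAt (S' := qfFull.toLatticeSituation) qfSetting m :=
  qf_not_frobEqualityAt m

/-- **`FrobVolumeTransport` FAILS in `qfSetting`** (by name). [folklore] -/
theorem qf_not_frobVolumeTransport' :
    ¬ Summit.ABC.IUTFork.Cor312Vol.FrobVolumeTransport (S' := qfFull.toLatticeSituation) qfSetting :=
  qf_not_frobVolumeTransport

/-- **THE B-INPUTS ARE NOT NECESSARY FOR THE TYPED COROLLARY 3.12 (by name; interface level).** In `qfSetting`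
the typed Theorem 3.11 (i) ∧ (ii) ∧ (iii), every bridge hypothesis, `|log(q)| > 0`, admissibility of the Kummer
images, (ii) (a) and the typed Corollary 3.12 HOLD, while `VolumeTransport`, `QFrobComparison`,
`FrobVolumeTransport` and every `QFrobEqualityAt m` FAIL. [folklore] -/
theorem qFrobComparison_not_necessary :
    ∃ (T : ThetaIndex) (F : FullSituation T) (P : Setting F.toLatticeSituation.toSituation),
      Summit.ABC.IUTFork.Thm311.FullSituation.Statement F ∧ Summit.ABC.IUTFork.Cor312Vol.BridgeHyps P ∧
        Summit.ABC.IUTFork.Cor312.Setting.AbsLogQPos P ∧ Summit.ABC.IUTFork.Cor312Vol.ThetaRegionsAdm P ∧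
        (F.col P.n).KummerA (F.D P.n) ∧ Summit.ABC.IUTFork.Cor312.Setting.Statement P ∧
        ¬ Summit.ABC.IUTFork.Cor312Vol.VolumeTransport P ∧
        ¬ Summit.ABC.IUTFork.Cor312Vol.QFrobComparison (S' := F.toLatticeSituation) P ∧
        ¬ Summit.ABC.IUTFork.Cor312Vol.FrobVolumeTransport (S' := F.toLatticeSituation) P ∧
        ∀ m : ℤ, ¬ Summit.ABC.IUTFork.Cor312Vol.QFrobEqualityAt (S' := F.toLatticeSituation) P m :=
  ⟨toyIndex, qfFull, qfSetting, qfFull_statement, qfSetting_bridgeHyps, qf_absLogQPos, qf_thetaRegionsAdm,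
    qf_kummerA, qf_statement, qf_not_volumeTransport, qf_not_qFrobComparison, qf_not_frobVolumeTransport',
    qf_not_qFrobEqualityAt⟩

end QFrobWitness

end Cor312Vol

end IUTFork

end Summit.ABC

end
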